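import Mathlib
import HarnessLib
import Summits.ResolutionOfSingularities.ResolutionOfSingularities.Theorems.WildQuotientsWildQuotientResolutionS1aFreeModelStep

/-!
# S1a — THE GENERAL ROOT MODEL: `R^w(A; e⁻¹x_v; w) ≃ k[x_none, x′_ι]` with pins, for any centre of distinct variables through `e : A ≃ k[x_ι]`

[OURS · L1 W4.5c · lead-1 g14; plan-1 RULING R-F15k (b2) «`exists_rootModelEquiv` = the GENERAL ROOT-MODEL PRODUCER (replacing A1Model for every future multi-shot
root)»] — NOT statements of the manuscript; counted 0; AI-level work, weaker than expert review. Crux stmt-ResolutionOfSingularities-17941 `CyclicQuotientFourfolds`, line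
`s1a-logminvertex` v13 (`stub_reachLowerInFX`). Pure algebra; EXISTENCE with pins (no new definitions), generalising ✓`A1.a1ModelEquiv` (centre (x₀,x₁), weights (2,1)).

For a ring isomorphism `e : A ≃+* k[x_ι]` (the root chart's sections), distinct centre variables `v : Fin c → ι` with weights `w`, and the weight function `W` on
all variables extending `w` by zero (`W (v i) = w i`, `W l = 0` off the image):
* ★★ `exists_rootModelEquiv` — `Ψ : R^w(A; e⁻¹ ∘ X ∘ v; w) ≃+* k[x_none, x′_ι]` with the PINS `Ψ(e⁻¹a) = subst a` (`x_l ↦ x_none^{W l}·x′_l`), `Ψ s = x_none`,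
  `Ψ (e⁻¹x_{v i}·t^{w i}) = x′_{v i}` — `CobordantTransport.congr e` ∘ weight-0 absorption (✓`FreeModel.exists_polyModelEquiv`);
* `exists_rootModelEquiv_X` — the same pins spelled on the variables: `Ψ(e⁻¹ x_l) = x_none^{W l} · x′_l`.
The producer chart rings of the root move are then `k[x_none, x′][1/Ψ(c)]` by ✓`chartRingEquivAway … Ψ` (`…S1aCobordantTransport`).
-/

set_option linter.dupNamespace false

noncomputable section

open Literature.AlgebraicGeometry.Resolution
open scoped LaurentPolynomial
open MvPolynomial
open Summit.ResolutionOfSingularities.ResolutionOfSingularities.Theorems.WildQuotientResolution.S1.CoarseChart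
open Summit.ResolutionOfSingularities.ResolutionOfSingularities.Theorems.WildQuotientResolution.S1.CobordantTransport

namespace Summit.ResolutionOfSingularities.ResolutionOfSingularities.Theorems.WildQuotientResolution.S1.FreeModel

variable {k : Type} [Field k] {ι : Type} {A : Type} [CommRing A] (e : A ≃+* MvPolynomial ι k)
  (W : ι → ℕ) {c : ℕ} (v : Fin c → ι) (w : Fin c → ℕ) (hvW : ∀ i, W (v i) = w i) (hW : ∀ l, W l = 0 ∨ ∃ i, v i = l)

/-- The family through `e`: `e ∘ (e⁻¹ ∘ X ∘ v) = X ∘ v`. -/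
theorem comp_symm_comp_X : (⇑e ∘ (⇑e.symm ∘ ((X : ι → MvPolynomial ι k) ∘ v))) = (X : ι → MvPolynomial ι k) ∘ v :=
  funext fun _ => e.apply_symm_apply _

/-- `R^w(A; e⁻¹ X∘v; w)` transported along `e` IS `R^w(k[x]; X∘v; w)`. -/
theorem cobordantAlgebra_comp_symm_eq :
    cobordantAlgebra (⇑e ∘ (⇑e.symm ∘ ((X : ι → MvPolynomial ι k) ∘ v))) w = cobordantAlgebra ((X : ι → MvPolynomial ι k) ∘ v) w := by
  rw [comp_symm_comp_X]

include hvW hW in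
/-- ★★ **THE GENERAL ROOT MODEL.** For `e : A ≃+* k[x_ι]`, distinct centre variables `v` with weights `w` and the extended weight function `W`:
`Ψ : R^w(A; e⁻¹ ∘ X ∘ v; w) ≃+* k[x_none, x′_ι]` with `Ψ(e⁻¹ a) = subst a`, `Ψ s = x_none`, `Ψ u′ᵢ = x′_{v i}`. [OURS · L1 W4.5c · R-F15k (b2); NOT a statement of
the manuscript] -/
theorem exists_rootModelEquiv :
    ∃ Ψ : ↥(cobordantAlgebra (⇑e.symm ∘ ((X : ι → MvPolynomial ι k) ∘ v)) w) ≃+* MvPolynomial (Option ι) k,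
      (∀ a : MvPolynomial ι k, Ψ (algebraMap A _ (e.symm a)) = cobordantAlgebra.subst k W a) ∧
      Ψ (cobordantAlgebra.s _ w) = X none ∧
      (∀ i, Ψ (cobordantAlgebra.u' (⇑e.symm ∘ ((X : ι → MvPolynomial ι k) ∘ v)) w i) = X (some (v i))) := by
  have hS : cobordantAlgebra (⇑e ∘ (⇑e.symm ∘ ((X : ι → MvPolynomial ι k) ∘ v))) w =
      cobordantAlgebra (cobordantAlgebra.coord k : ι → MvPolynomial ι k) W := by
    rw [comp_symm_comp_X, cobordantAlgebra_X_comp_eq k W v w hvW hW]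
  obtain ⟨Ψ₀, ha, hs, hu⟩ := exists_polyModelEquiv_of_eq k W _ hS
  refine ⟨(congr e _ w).trans Ψ₀, fun a => ?_, ?_, fun i => ?_⟩
  · rw [RingEquiv.trans_apply]
    exact ha _ a (by rw [coe_congr, cobordantAlgebra.coe_algebraMap, mapT_C, e.apply_symm_apply])
  · rw [RingEquiv.trans_apply]
    exact hs _ (by rw [coe_congr, cobordantAlgebra.coe_s, mapT_T])
  · rw [RingEquiv.trans_apply]
    refine hu _ (v i) ?_
    rw [coe_congr, cobordantAlgebra.coe_u', mapT_C_mul_T, hvW]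
    simp only [Function.comp_apply, e.apply_symm_apply]

include hvW hW in
/-- **The pins on the variables**: `Ψ(e⁻¹ x_l) = x_none^{W l} · x′_l` (Włodarczyk's `x = s^w x′`; weight-0 variables go to themselves). [OURS · L1 W4.5c] -/
theorem exists_rootModelEquiv_X :
    ∃ Ψ : ↥(cobordantAlgebra (⇑e.symm ∘ ((X : ι → MvPolynomial ι k) ∘ v)) w) ≃+* MvPolynomial (Option ι) k,
      (∀ a : MvPolynomial ι k, Ψ (algebraMap A _ (e.symm a)) = cobordantAlgebra.subst k W a) ∧
      (∀ l : ι, Ψ (algebraMap A _ (e.symm (X l))) = X none ^ W l * X (some l)) ∧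
      Ψ (cobordantAlgebra.s _ w) = X none ∧
      (∀ i, Ψ (cobordantAlgebra.u' (⇑e.symm ∘ ((X : ι → MvPolynomial ι k) ∘ v)) w i) = X (some (v i))) := by
  obtain ⟨Ψ, ha, hs, hu⟩ := exists_rootModelEquiv e W v w hvW hW
  refine ⟨Ψ, ha, fun l => ?_, hs, hu⟩
  rw [ha, cobordantAlgebra.subst, MvPolynomial.eval₂Hom_X']

end Summit.ResolutionOfSingularities.ResolutionOfSingularities.Theorems.WildQuotientResolution.S1.FreeModel

end
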